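import Summits.AnomalousDissipation.AnomalousDissipation.Theses.QuarticLadder
import Summits.AnomalousDissipation.AnomalousDissipation.Theorems.UniformResolution.Negative.Shape

/-!
# Strategist r1 sketch — crux `UniformResolution` (stmt-AnomalousDissipation-14330), route QuarticLadder

Typed companion of `STRATEGY-CENSUS.md` Part R1 (seat planner-cstrat-stmt-AnomalousDissipation-14330-r1-0,
2026-08-17). Kernel-checked content:

* `quarticLadder_iff_momentParity'` — the two route rows are one proposition (`Iff.rfl`).
* §D-r1-1 THE ORDER SPLIT (the route's own axis, the moment order `d`): `IsResolvedLoudFamilyAtOrder`,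
  `OrderwiseResolution` (for every order `d` SEPARATELY a resolved loud `d`-stationary family, constants allowed
  to depend on `d`), `OrderUniformization` (orderwise ⇒ order-uniform), the assembly
  `uniformResolution_of_orderwise : OrderwiseResolution → OrderUniformization → UniformResolution` and the
  converse `orderwise_of_uniformResolution : UniformResolution → OrderwiseResolution` (the first piece is a
  CONSEQUENCE of the crux; all open content of the split sits in the uniformization, census §Decomposition).
* §S-r1-2 THE COMPONENT FORM: `IsLoudAtomAt` (ONE loud law per level, the shape after ergodic reduction) and
  `uniformResolution_iff_atomwise` — the antecedent may equivalently be read one law at a time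
  (`IsLoudFamilyAt` already quantifies `∃ μ` per `(N, d)`; recorded to fix notation for the census' ergodic
  reduction, whose measure-theoretic step (ergodic decomposition at level `N`) is informal).

No `sorry`. Nothing here is a route item or a line; the census explains why neither piece of the split is filed.
-/

set_option linter.dupNamespace false

namespace Summit.AnomalousDissipation.AnomalousDissipation.Cruxes.UniformResolution.StrategistR1

open MeasureTheory Filter Topology
open scoped ENNReal
open Literature.Analysis.FunctionSpaces Literature.Analysis.FluidPDE
open Summit.AnomalousDissipation.AnomalousDissipation.Theses
open Summit.AnomalousDissipation.AnomalousDissipation.Theorems.QuarticGate.Negative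
open Summit.AnomalousDissipation.AnomalousDissipation.Theorems.UniformResolution.Negative

noncomputable section

/-- The two ledger rows of stmt-14330 are one proposition. [folklore] -/
theorem quarticLadder_iff_momentParity' :
    QuarticLadder.UniformResolution ↔ MomentParity.UniformResolution :=
  Iff.rfl

/-! ## §D-r1-1 The order split -/

/-- Resolved loud `d`-stationary level laws at ONE order `d` (the law, the ball and the schedule may depend on
`d`): `∃ R κ, ∃ᶠ N, ∃ μ` level-`N`, ball `R`, `κ`-resolved, `d`-stationary at `(ν, f)`, energy `≤ E`,
dissipation `≥ ε`. -/
def IsResolvedLoudFamilyAtOrder (f : UnitAddTorus (Fin 3) → EuclideanSpace ℝ (Fin 3)) (ν E ε : ℝ)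
    (d : ℕ) : Prop :=
  ∃ (R : ℝ) (κ : ℕ → ℕ), ∃ᶠ N in atTop, ∃ μ : Measure (Torus.energySpace (Fin 3)),
    IsProbabilityMeasure μ ∧ (∀ᵐ u ∂μ, IsLevel N u) ∧ (∀ᵐ u ∂μ, ‖u‖ ≤ R) ∧ IsResolved κ μ ∧
    IsPolyStationary ν f N d μ ∧ Torus.ensembleEnergy μ ≤ E ∧ ε ≤ Torus.ensembleDissipation ν μ

/-- ORDERWISE RESOLUTION: under the antecedent of `UniformResolution`, for EVERY FIXED order `d` there are
budgets `E'_d`, `ε'_d > 0` (allowed to depend on `d`) and at every `j` a resolved loud `d`-stationary family.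
At finite `d` this is a truncated-moment / pseudo-ensemble statement (surgery on finitely many rows). -/
def OrderwiseResolution : Prop :=
  ∀ f : UnitAddTorus (Fin 3) → EuclideanSpace ℝ (Fin 3),
    Torus.IsSmooth f → Torus.IsDivFree f → Torus.HasZeroMean f →
    ∀ (ν : ℕ → ℝ) (E ε : ℝ), (∀ j, 0 < ν j) → Tendsto ν atTop (𝓝 0) → 0 < ε →
    (∀ j : ℕ, IsLoudFamilyAt f (ν j) E ε) →
    ∀ d : ℕ, ∃ E' ε' : ℝ, 0 < ε' ∧ ∀ j : ℕ, IsResolvedLoudFamilyAtOrder f (ν j) E' ε' d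

/-- ORDER UNIFORMIZATION: orderwise resolved loud families (constants depending on `d`) ⇒ resolved loud
families with a COMMON ball, schedule and budgets across `d` (the conclusion of `UniformResolution`).
A tightness-in-`d` statement; open both ways (census §Decomposition D-r1-1). -/
def OrderUniformization : Prop :=
  ∀ f : UnitAddTorus (Fin 3) → EuclideanSpace ℝ (Fin 3),
    Torus.IsSmooth f → Torus.IsDivFree f → Torus.HasZeroMean f →
    ∀ (ν : ℕ → ℝ), (∀ j, 0 < ν j) → Tendsto ν atTop (𝓝 0) →
    (∀ d : ℕ, ∃ E' ε' : ℝ, 0 < ε' ∧ ∀ j : ℕ, IsResolvedLoudFamilyAtOrder f (ν j) E' ε' d) →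
    ∃ E' ε' : ℝ, 0 < ε' ∧ ∀ j : ℕ, IsResolvedLoudFamilyAt f (ν j) E' ε'

/-- **Assembly of the order split** (pure logic). [folklore] -/
theorem uniformResolution_of_orderwise (h₁ : OrderwiseResolution) (h₂ : OrderUniformization) :
    QuarticLadder.UniformResolution := by
  rw [quarticLadder_iff_momentParity', uniformResolution_iff]
  intro f hfs hfd hfz ν E ε hν hν0 hε hloud
  exact h₂ f hfs hfd hfz ν hν hν0 (h₁ f hfs hfd hfz ν E ε hν hν0 hε hloud)

/-- The conclusion body at one `ν` gives the orderwise body at every order (move `∀ d` outside `∃ᶠ N`).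
[folklore] -/
theorem atOrder_of_isResolvedLoudFamilyAt {f : UnitAddTorus (Fin 3) → EuclideanSpace ℝ (Fin 3)}
    {ν E ε : ℝ} (h : IsResolvedLoudFamilyAt f ν E ε) (d : ℕ) :
    IsResolvedLoudFamilyAtOrder f ν E ε d := by
  obtain ⟨R, κ, hfreq⟩ := h
  exact ⟨R, κ, hfreq.mono fun N hN => hN d⟩

/-- **The first piece is a consequence of the crux**: `UniformResolution → OrderwiseResolution` (so the
split reads `UR ⟺ Orderwise ∧ (Orderwise-with-d-dependent-constants ⇒ order-uniform)`; all open content is in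
the uniformization). [folklore] -/
theorem orderwise_of_uniformResolution (h : QuarticLadder.UniformResolution) : OrderwiseResolution := by
  rw [quarticLadder_iff_momentParity', uniformResolution_iff] at h
  intro f hfs hfd hfz ν E ε hν hν0 hε hloud d
  obtain ⟨E', ε', hε', hres⟩ := h f hfs hfd hfz ν E ε hν hν0 hε hloud
  exact ⟨E', ε', hε', fun j => atOrder_of_isResolvedLoudFamilyAt (hres j) d⟩

/-! ## §S-r1-2 The component (one-law-per-level) form -/

/-- ONE loud law at level `N`, order `d`, ball `R` (the shape left after the census' ergodic reduction). -/
def IsLoudAtomAt (f : UnitAddTorus (Fin 3) → EuclideanSpace ℝ (Fin 3)) (ν E ε R : ℝ) (N d : ℕ)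
    (μ : Measure (Torus.energySpace (Fin 3))) : Prop :=
  IsProbabilityMeasure μ ∧ (∀ᵐ u ∂μ, IsLevel N u) ∧ (∀ᵐ u ∂μ, ‖u‖ ≤ R) ∧
    IsPolyStationary ν f N d μ ∧ Torus.ensembleEnergy μ ≤ E ∧ ε ≤ Torus.ensembleDissipation ν μ

/-- The antecedent body is literally "a ball and, `N`-frequently, for every `d`, one loud atom". [folklore] -/
theorem isLoudFamilyAt_iff_atomwise (f : UnitAddTorus (Fin 3) → EuclideanSpace ℝ (Fin 3)) (ν E ε : ℝ) :
    IsLoudFamilyAt f ν E ε ↔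
      ∃ R : ℝ, ∃ᶠ N in atTop, ∀ d : ℕ, ∃ μ : Measure (Torus.energySpace (Fin 3)),
        IsLoudAtomAt f ν E ε R N d μ :=
  Iff.rfl

/-- `UniformResolution` read atomwise (definitional). [folklore] -/
theorem uniformResolution_iff_atomwise :
    QuarticLadder.UniformResolution ↔ ∀ f : UnitAddTorus (Fin 3) → EuclideanSpace ℝ (Fin 3),
      Torus.IsSmooth f → Torus.IsDivFree f → Torus.HasZeroMean f →
      ∀ (ν : ℕ → ℝ) (E ε : ℝ), (∀ j, 0 < ν j) → Tendsto ν atTop (𝓝 0) → 0 < ε →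
      (∀ j : ℕ, ∃ R : ℝ, ∃ᶠ N in atTop, ∀ d : ℕ, ∃ μ : Measure (Torus.energySpace (Fin 3)),
        IsLoudAtomAt f (ν j) E ε R N d μ) →
      ∃ E' ε' : ℝ, 0 < ε' ∧ ∀ j : ℕ, IsResolvedLoudFamilyAt f (ν j) E' ε' :=
  Iff.rfl

end

end Summit.AnomalousDissipation.AnomalousDissipation.Cruxes.UniformResolution.StrategistR1
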